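import Mathlib
import HarnessLib
import Summits.HubbardSuperconductivity.HubbardSuperconductivity.Theorems.KLProgrammeKLRegimeSectorSlicePairWtFatData
import Summits.HubbardSuperconductivity.HubbardSuperconductivity.Theorems.KLProgrammeKLRegimeSectorSliceIncrPairMoment
import Summits.HubbardSuperconductivity.HubbardSuperconductivity.Theorems.KLProgrammeKLRegimeSectorSliceDefectPairAlgebra

/-!
# Route `KLProgramme` — VL child `KLRegimeVolumeLimitV17F2` (stmt-HubbardSuperconductivity-20440), closer MODEL file M2 «MISMATCH-SLICE», part 2b:
# the UNIFORM weighted per-pair bound of the sectorised slice DEFECT `S(F̃)ᵀ·(C^{K′}_{(Λ,Λ′]} − C^{K}_{(Λ,Λ′]})·S(F̃)` for the FAT family on the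
# frame `K`, in CLOSED FORM for ARBITRARY positive rates — every term carries the band increment `e_{K′} − e_K` (`P₀ … P₃`)

Cell `gate-hubbard-kl`, seat hubbard-kl-k3c4-p2 (g11; UV / Matsubara all-U lane), ask «MISMATCH-SLICE» (= M2, bracket (b)) of the VL registrant
k3c4-p1 g11 (KL STATUS 2026-08-27 21:51Z; pen (R75)).  The DEFECT twin of p3's `slicePairWt_bgmFat_le` (`…SectorSlicePairWtFat`): the fat pair
`F̃_{m+1,ω}F̃_{m+1,ω′}` on the frame `K` (its UNIFORM multiplier data of orders `≤ 3` = p3's `bgmFatPairWt_data`, same section hypotheses) against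
k3c3-p2's INCREMENT pair lemma `…SectorSliceIncrPairMoment.sliceIncrPairWt_charSum_l1_le` (frames `K, K′`, increment `v = e_{K′} − e_K` with
`|v| ≤ P₀`, `‖Dv‖ ≤ P₁`, `‖D²v‖ ≤ P₂`, `‖D³v‖ ≤ P₃`; band `‖Dⁱe_K‖ ≤ Kᵢ`; cutoff `B₁ … B₄`).  Since the amplitude `A₀` of the increment lemma is
FREE, the six rate inequalities are discharged BY CONSTRUCTION for ANY positive rates `s₀, s₁, s₂, s₃, s₃′`: the left-hand sides are homogeneous
in the step norm (`incrLhs3_eq`, `incrLhs2_eq`: `c₀²·(t³X₃ + 3a₁t²X₂ + 3a₂tX₁ + a₃X₀)`, `c₀²·(t²X₂ + 2a₁tX₁ + a₂X₀)` with `X₀ … X₃` explicit,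
every monomial carrying one of `P₀ … P₃`), the step norms are `≤ √2ℓ₁` (axes) / `≤ √2ℓ` (normal, tangent), and
`A₀^Δ := c₀²X₀ + T_t/(4/(s₀·2M))³ + E/(4/(s₁L))³ + N/(4/(s₂L))³ + V₂/(4/(s₃L))² + V₃/(4/(s₃′L))³` dominates each left side times its rate factor:

* (part 2a `…SectorSliceDefectPairAlgebra`: `incrLhs3_eq`, `incrLhs2_eq`, `incrPoly3_mono`, `incrPoly2_mono`, `le_mul_of_div_le'`);
* **`sliceDefectPairWt_bgmFat_le`** — for every pair `(ω, ω′)`, every integer frame vector `v` of `ω` (`|v_j| ≤ N_r + ½`, `|v| ≥ N_r − 1`,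
  tangency as in `bgmFatPairWt_data`) and ALL positive rates:
  `Σ_z (1 + s₀|z̃₁| + s₁|z̃₂|₁)·‖S[(βL²)⁻²F̃_ωF̃_{ω′}(Ψ̂[K′] − Ψ̂[K])]‖(z) ≤ √W(s; N_r−1, R₀)·√(24·2M·L²·N̄_s)·A₀^Δ`
  with p3's `W` and `N̄_s` VERBATIM (so `rowSumWt_sliceCT_sub_bgmFat_le_of_pairBound` of part 1 turns it into the defect `hrow/hcol` with the SAME
  weight domination `D` as the one-frame rows `…AlphaWtClosedRows`), `A₀^Δ` the closed amplitude above (abbreviation hypotheses, instantiate by `rfl`).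

Everything is proved; no definitions, no named facts; nothing about the model is asserted.  Part 3 instantiates `K, K′` at the two volumes' top flow
frames (`P_i = c_i(n⋆)/L` from `…TwoVolumeFrameDefect.lineDiff…`/`coeffNorm_fsub_klFlowFrameU_le_of_towerV17F2`). [folklore]

References: G. Benfatto, A. Giuliani, V. Mastropietro, Ann. Henri Poincaré 7 (2006) 809–898, §2.7 (2.66)–(2.71a), §2.8 (2.81), §3 (3.2)–(3.8).
-/

noncomputable section

namespace Summit.HubbardSuperconductivity.HubbardSuperconductivity.Theorems.TorusFourierL2

set_option linter.dupNamespace false -- summit = problem name (single-conjunct summit), D-0017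

open Set Finset Literature.MathematicalPhysics.QuantumLattice Literature.MathematicalPhysics.QuantumLattice.BandSectorCounting
open Literature.MathematicalPhysics.QuantumLattice.FermiRG Literature.Probability.LatticeModels Literature.Analysis.SpecialFunctions
open Summit.HubbardSuperconductivity.HubbardSuperconductivity.Theorems.DispersionFlow
open Summit.HubbardSuperconductivity.HubbardSuperconductivity.Theorems.KLRegimeSplit
open Summit.HubbardSuperconductivity.HubbardSuperconductivity.Theorems.KLProgrammeLegKernels
open Summit.HubbardSuperconductivity.HubbardSuperconductivity.Theorems.PerturbedFermiCurve
open scoped Real Nat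


/-! ## The uniform weighted per-pair bound of the slice DEFECT for the fat family, closed form, arbitrary positive rates -/

section PairBound

open Classical

variable {L M : ℕ} [NeZero L] [NeZero M] {a b : ℝ} (B : BandBounds a b) {K K' : TrigPolyC4v} {A : ℝ}
  (hA : ∀ p : Momentum, ∀ j ≤ 2, ‖iteratedFDeriv ℝ j (frameShift K) p‖ ≤ A) (hADt : 2 * A < B.Dtmin)
  {μ e₀ z β : ℝ} (he : 0 < e₀) (hz : 0 < z) (hz1 : z ≤ 1) (hgap : e₀ + A + z ^ 2 < -μ) (h3 : e₀ + A - μ ≤ 3)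
  (hlo : a ≤ μ - A - e₀) (hhi : μ + A + e₀ ≤ b) (hβ : 0 < β) (hρA : 4 * A < 2 * B.rhomin)
  (m : ℕ) (hMm : klScale e₀ m * β < π * (2 * M - 5))
  {d : ℝ} (hd : 0 ≤ d) (hd1 : ∀ u, |deriv (bgmCutoffSq e₀) u| ≤ d) (hd2 : ∀ u, |iteratedDeriv 2 (bgmCutoffSq e₀) u| ≤ d)
  (hd3 : ∀ u, |iteratedDeriv 3 (bgmCutoffSq e₀) u| ≤ d)
  {A₃ a₃ : ℝ} (hA3 : ∀ p : Momentum, ‖iteratedFDeriv ℝ 3 (frameShift K) p‖ ≤ A₃) (ha3 : A₃ * klScale e₀ m ^ 2 ≤ a₃)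
  {Ba : ℝ} (hB0 : 0 ≤ Ba)
  (hB : ∀ (i : ℕ), i ≤ 2 → ∀ (n : ℕ) (ω : ℤ) (θ₀ : ℝ) (q w : Fin 2 → ℝ) (t : ℝ) {r₀ : ℝ}, 0 < r₀ →
    r₀ ≤ ‖momToComplex (q + t • w)‖ → |sectorRelAngle θ₀ (q + t • w)| < π →
    ‖iteratedDeriv i (fun t : ℝ => sectorWeightCirc n ω (polarAngle (q + t • w))) t‖ ≤
      (2 : ℕ)! * Ba * ((1 + (sectorWidth n)⁻¹ * (2 : ℕ)!) * ‖momToComplex w‖ / r₀) ^ i)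
  {Ba3 : ℝ} (hB30 : 0 ≤ Ba3)
  (hB3 : ∀ (i : ℕ), i ≤ 3 → ∀ (n : ℕ) (ω : ℤ) (θ₀ : ℝ) (q w : Fin 2 → ℝ) (t : ℝ) {r₀ : ℝ}, 0 < r₀ →
    r₀ ≤ ‖momToComplex (q + t • w)‖ → |sectorRelAngle θ₀ (q + t • w)| < π →
    ‖iteratedDeriv i (fun t : ℝ => sectorWeightCirc n ω (polarAngle (q + t • w))) t‖ ≤
      (3 : ℕ)! * Ba3 * ((1 + (sectorWidth n)⁻¹ * (3 : ℕ)!) * ‖momToComplex w‖ / r₀) ^ i)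
  -- the slice and the Euclidean frame data of the propagator side (frame `K`)
  {Λ Λ' : ℝ} (hΛ : 0 < Λ) (hΛΛ' : Λ ≤ Λ') (hM' : Λ' < π * (2 * M - 5) / β)
  {K₁ K₂ K₃ : ℝ} (hK₁ : ∀ p, ‖fderiv ℝ (frameLevel μ K) p‖ ≤ K₁) (hK₂ : ∀ p, ‖iteratedFDeriv ℝ 2 (frameLevel μ K) p‖ ≤ K₂)
  (hK₃ : ∀ p, ‖iteratedFDeriv ℝ 3 (frameLevel μ K) p‖ ≤ K₃)
  {B₁ B₂ B₃ B₄ : ℝ} (hB₁ : ∀ x, |deriv salmhoferCutoff x| ≤ B₁) (hB₂ : ∀ x, |deriv (deriv salmhoferCutoff) x| ≤ B₂)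
  (hB₃ : ∀ x, |deriv (deriv (deriv salmhoferCutoff)) x| ≤ B₃) (hB₄ : ∀ x, |deriv (deriv (deriv (deriv salmhoferCutoff))) x| ≤ B₄)
  -- the band increment `e_{K′} − e_K` of the second frame
  {P₀ P₁ P₂ P₃ : ℝ} (hv₀ : ∀ p, |frameLevel μ K' p - frameLevel μ K p| ≤ P₀)
  (hv₁ : ∀ p, ‖fderiv ℝ (fun p => frameLevel μ K' p - frameLevel μ K p) p‖ ≤ P₁)
  (hv₂ : ∀ p, ‖iteratedFDeriv ℝ 2 (fun p => frameLevel μ K' p - frameLevel μ K p) p‖ ≤ P₂)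
  (hv₃ : ∀ p, ‖iteratedFDeriv ℝ 3 (fun p => frameLevel μ K' p - frameLevel μ K p) p‖ ≤ P₃)
  -- tangent resolution, zone margin for the steps, far-region radius
  {Nr : ℝ} (hNr : 2 ≤ Nr) (hLz : 3 * |2 * π / L| * (Nr + 1 / 2) ≤ z) {R₀ : ℕ} (hR₀ : 2 * (2 * Nr + 1) * (R₀ : ℝ) < L)
  -- abbreviations (instantiate with `rfl`)
  {ℓ₁ ℓ ρf G₁ G₂ G₃ Kp wsi τt Ae1 Ae2 An1 An2 Av1 Av2 κ₃F : ℝ}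
  (hℓ₁ : ℓ₁ = 2 * π / L) (hℓ : ℓ = 2 * π / L * (Nr + 1 / 2))
  (hρf : ρf = (klScale e₀ m + B.smax * B.Dtmin * (3 * sectorWidth (m + 1) / 4)) / (B.Dtmin - 2 * A) +
    π * Real.sqrt 2 * (1 + (4 + 2 * A) / (B.Dtmin - 2 * A)) * sectorWidth (m + 1))
  (hG₁ : G₁ = d * e₀ ^ 2 * 1 + 1 * (d * e₀ ^ 2)) (hG₂ : G₂ = d * e₀ ^ 4 * 1 + 2 * (d * e₀ ^ 2) * (d * e₀ ^ 2) + 1 * (d * e₀ ^ 4))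
  (hG₃ : G₃ = d * e₀ ^ 6 * 1 + 3 * (d * e₀ ^ 4) * (d * e₀ ^ 2) + 3 * (d * e₀ ^ 2) * (d * e₀ ^ 4) + 1 * (d * e₀ ^ 6))
  (hκ₃F : κ₃F = (8 * G₃ + 12 * G₂) * (4 + 2 * A) ^ 3 + (12 * G₂ + 6 * G₁) * (4 + 2 * A) * (4 + 4 * A) * e₀ +
      2 * G₁ * (4 * e₀ ^ 2 + 8 * a₃) +
      216 * 9 * Ba3 * ((4 * G₂ + 2 * G₁) * (4 + 2 * A) ^ 2 * (2 * e₀) + 2 * G₁ * (4 + 4 * A) * e₀ * (2 * e₀)) +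
      216 * 9 * G₁ * (4 + 2 * A) * (12 * Ba3 + 72 * Ba3 ^ 2) * (2 * e₀) ^ 2 + 216 * 9 * (12 * Ba3 + 216 * Ba3 ^ 2) * (2 * e₀) ^ 3)
  (hKp : Kp = 4 + 4 * A) (hwsi : wsi = (sectorWidth (m + 1))⁻¹)
  (hτt : τt = |2 * π / L| * (4 + 2 * A) + K₂ * (Real.sqrt 2 * ρf) * (Real.sqrt 2 * ℓ))
  (hAe1 : Ae1 = 2 * G₁ * ((4 + 2 * A) * ℓ₁ + Kp * (ρf + 2 * ℓ₁) * ℓ₁) / klScale e₀ m * 1 + 1 * 1 * (9 * (4 * Ba * ((1 + 2 * wsi) * (2 * ℓ₁)))))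
  (hAe2 : Ae2 = ((4 * G₂ + 2 * G₁) * ((4 + 2 * A) * ℓ₁ + Kp * (ρf + 2 * ℓ₁) * ℓ₁) ^ 2 / klScale e₀ m ^ 2 + 2 * G₁ * (Kp * ℓ₁ ^ 2) / klScale e₀ m) * 1 +
    4 * G₁ * ((4 + 2 * A) * ℓ₁ + Kp * (ρf + 2 * ℓ₁) * ℓ₁) / klScale e₀ m * (9 * (4 * Ba * ((1 + 2 * wsi) * (2 * ℓ₁)))) +
    1 * 1 * (9 * (4 * Ba * ((1 + 2 * wsi) * (2 * ℓ₁)) ^ 2 + 8 * Ba ^ 2 * ((1 + 2 * wsi) * (2 * ℓ₁)) ^ 2)))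
  (hAn1 : An1 = 2 * G₁ * ((4 + 2 * A) * ℓ + Kp * (ρf + 2 * ℓ) * ℓ) / klScale e₀ m * 1 + 1 * 1 * (9 * (4 * Ba * ((1 + 2 * wsi) * (2 * ℓ)))))
  (hAn2 : An2 = ((4 * G₂ + 2 * G₁) * ((4 + 2 * A) * ℓ + Kp * (ρf + 2 * ℓ) * ℓ) ^ 2 / klScale e₀ m ^ 2 + 2 * G₁ * (Kp * ℓ ^ 2) / klScale e₀ m) * 1 +
    4 * G₁ * ((4 + 2 * A) * ℓ + Kp * (ρf + 2 * ℓ) * ℓ) / klScale e₀ m * (9 * (4 * Ba * ((1 + 2 * wsi) * (2 * ℓ)))) +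
    1 * 1 * (9 * (4 * Ba * ((1 + 2 * wsi) * (2 * ℓ)) ^ 2 + 8 * Ba ^ 2 * ((1 + 2 * wsi) * (2 * ℓ)) ^ 2)))
  (hAv1 : Av1 = 2 * G₁ * (|2 * π / L| * (4 + 2 * A) + Kp * (ρf + 2 * ℓ) * ℓ) / klScale e₀ m * 1 + 1 * 1 * (9 * (4 * Ba * ((1 + 2 * wsi) * (2 * ℓ)))))
  (hAv2 : Av2 = ((4 * G₂ + 2 * G₁) * (|2 * π / L| * (4 + 2 * A) + Kp * (ρf + 2 * ℓ) * ℓ) ^ 2 / klScale e₀ m ^ 2 + 2 * G₁ * (Kp * ℓ ^ 2) / klScale e₀ m) * 1 +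
    4 * G₁ * (|2 * π / L| * (4 + 2 * A) + Kp * (ρf + 2 * ℓ) * ℓ) / klScale e₀ m * (9 * (4 * Ba * ((1 + 2 * wsi) * (2 * ℓ)))) +
    1 * 1 * (9 * (4 * Ba * ((1 + 2 * wsi) * (2 * ℓ)) ^ 2 + 8 * Ba ^ 2 * ((1 + 2 * wsi) * (2 * ℓ)) ^ 2)))
  -- the increment polynomials and the closed amplitude (instantiate with `rfl`)
  {X₀ X₁ X₂ X₃ Tt : ℝ}
  (hX₀ : X₀ = (16 * B₁ + 16) * (β * (L : ℝ) ^ 2) / Λ ^ 2 * P₀)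
  (hX₁ : X₁ = (32 * B₂ + 144 * B₁ + 128) * (β * (L : ℝ) ^ 2) / Λ ^ 3 * P₀ * (K₁ + P₁) + (16 * B₁ + 16) * (β * (L : ℝ) ^ 2) / Λ ^ 2 * P₁)
  (hX₂ : X₂ = (64 * B₃ + 480 * B₂ + 1728 * B₁ + 1536) * (β * (L : ℝ) ^ 2) / Λ ^ 4 * P₀ * (K₁ + P₁) ^ 2 +
    (32 * B₂ + 144 * B₁ + 128) * (β * (L : ℝ) ^ 2) / Λ ^ 3 * (P₁ * (2 * K₁ + P₁)) +
    ((32 * B₂ + 144 * B₁ + 128) * (β * (L : ℝ) ^ 2) / Λ ^ 3 * P₀ * (K₂ + P₂) + (16 * B₁ + 16) * (β * (L : ℝ) ^ 2) / Λ ^ 2 * P₂))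
  (hX₃ : X₃ = (128 * B₄ + 1408 * B₃ + 7776 * B₂ + 27648 * B₁ + 24576) * (β * (L : ℝ) ^ 2) / Λ ^ 5 * P₀ * (K₁ + P₁) ^ 3 +
    (64 * B₃ + 480 * B₂ + 1728 * B₁ + 1536) * (β * (L : ℝ) ^ 2) / Λ ^ 4 * (P₁ * (3 * K₁ ^ 2 + 3 * K₁ * P₁ + P₁ ^ 2)) +
    3 * ((64 * B₃ + 480 * B₂ + 1728 * B₁ + 1536) * (β * (L : ℝ) ^ 2) / Λ ^ 4 * P₀ * ((K₁ + P₁) * (K₂ + P₂)) +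
      (32 * B₂ + 144 * B₁ + 128) * (β * (L : ℝ) ^ 2) / Λ ^ 3 * (K₁ * P₂ + P₁ * K₂ + P₁ * P₂)) +
    ((32 * B₂ + 144 * B₁ + 128) * (β * (L : ℝ) ^ 2) / Λ ^ 3 * P₀ * (K₃ + P₃) + (16 * B₁ + 16) * (β * (L : ℝ) ^ 2) / Λ ^ 2 * P₃))
  (hTt : Tt = (1 / (β * (L : ℝ) ^ 2)) ^ 2 *
    (1 * ((2 * π / β) ^ 3 * ((128 * B₄ + 1216 * B₃ + 6912 * B₂ + 26112 * B₁ + 24576) * (β * (L : ℝ) ^ 2) / Λ ^ 5 * P₀)) +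
      3 * ((2 * G₁ * |2 * π / β| * 1 / klScale e₀ m) * ((2 * π / β) ^ 2 * ((64 * B₃ + 416 * B₂ + 1600 * B₁ + 1536) * (β * (L : ℝ) ^ 2) / Λ ^ 4 * P₀))) +
      3 * (((4 * G₂ + 2 * G₁) * (2 * π / β) ^ 2 * 1 / klScale e₀ m ^ 2) * ((2 * π / β) * ((32 * B₂ + 128 * B₁ + 128) * (β * (L : ℝ) ^ 2) / Λ ^ 3 * P₀))) +
      ((8 * G₃ + 12 * G₂) * |2 * π / β| ^ 3 * 1 / klScale e₀ m ^ 3) * ((16 * B₁ + 16) * (β * (L : ℝ) ^ 2) / Λ ^ 2 * P₀)))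

include B hA hADt he hz hz1 hgap h3 hlo hhi hβ hρA hMm hd hd1 hd2 hd3 hA3 ha3 hB0 hB hB30 hB3 hΛ hΛΛ' hM' hK₁ hK₂ hK₃ hB₁ hB₂ hB₃ hB₄
  hv₀ hv₁ hv₂ hv₃ hNr hLz hR₀ hℓ₁ hℓ hρf hG₁ hG₂ hG₃ hκ₃F hKp hwsi hτt hAe1 hAe2 hAn1 hAn2 hAv1 hAv2 hX₀ hX₁ hX₂ hX₃ hTt in
set_option maxHeartbeats 4000000 in
/-- **The uniform WEIGHTED per-pair bound of the slice DEFECT for the fat family, closed form, arbitrary positive rates** (see the module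
docstring).  (One disclosed heartbeat raise: statement size, as in the one-frame twin `slicePairWt_bgmFat_le`.)
[cite: BenfattoGiulianiMastropietro2006, §2.8 (2.81), §3 (3.2)–(3.8)] -/
theorem sliceDefectPairWt_bgmFat_le (ω ω' : Fin (sectorCount (m + 1))) (v : Fin 2 → ℤ) (hv : v ≠ 0)
    (hvj : ∀ j, |(v j : ℝ)| ≤ Nr + 1 / 2) (hvlen : Nr - 1 ≤ Real.sqrt ((v 0 : ℝ) ^ 2 + (v 1 : ℝ) ^ 2))
    (hvtan : |fderiv ℝ (fun p : Fin 2 → ℝ => frameLevel μ K (WithLp.toLp 2 p)) (klFermiPoint μ K (sectorCenter (m + 1) (ω : ℕ)))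
      (fun j => 2 * π / L * (v j : ℝ))| ≤ |2 * π / L| * (4 + 2 * A))
    {s₀ s₁ s₂ s₃ s₃' : ℝ} (hs₀ : 0 < s₀) (hs₁ : 0 < s₁) (hs₂ : 0 < s₂) (hs₃ : 0 < s₃) (hs₃' : 0 < s₃')
    {AΔ : ℝ} (hAΔ : AΔ = (1 / (β * (L : ℝ) ^ 2)) ^ 2 * X₀ + Tt / (4 / (s₀ * (2 * M : ℕ))) ^ 3 +
      (1 / (β * (L : ℝ) ^ 2)) ^ 2 * ((Real.sqrt 2 * ℓ₁) ^ 3 * X₃ + 3 * (Ae1 * ((Real.sqrt 2 * ℓ₁) ^ 2 * X₂)) +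
        3 * (Ae2 * ((Real.sqrt 2 * ℓ₁) * X₁)) + κ₃F * ℓ₁ ^ 3 / klScale e₀ m ^ 3 * X₀) / (4 / (s₁ * L)) ^ 3 +
      (1 / (β * (L : ℝ) ^ 2)) ^ 2 * ((Real.sqrt 2 * ℓ) ^ 3 * X₃ + 3 * (An1 * ((Real.sqrt 2 * ℓ) ^ 2 * X₂)) +
        3 * (An2 * ((Real.sqrt 2 * ℓ) * X₁)) + κ₃F * ℓ ^ 3 / klScale e₀ m ^ 3 * X₀) / (4 / (s₂ * L)) ^ 3 +
      (1 / (β * (L : ℝ) ^ 2)) ^ 2 * ((Real.sqrt 2 * ℓ) ^ 2 * X₂ + 2 * (Av1 * ((Real.sqrt 2 * ℓ) * X₁)) + Av2 * X₀) / (4 / (s₃ * L)) ^ 2 +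
      (1 / (β * (L : ℝ) ^ 2)) ^ 2 * ((Real.sqrt 2 * ℓ) ^ 3 * X₃ + 3 * (Av1 * ((Real.sqrt 2 * ℓ) ^ 2 * X₂)) +
        3 * (Av2 * ((Real.sqrt 2 * ℓ) * X₁)) + κ₃F * ℓ ^ 3 / klScale e₀ m ^ 3 * X₀) / (4 / (s₃' * L)) ^ 3) :
    ∑ z : TorusSite 1 (2 * M) × TorusSite 2 L,
        (1 + s₀ * |(((z.1 0).valMinAbs : ℤ) : ℝ)| + s₁ * |(((z.2 0).valMinAbs : ℤ) : ℝ)| + s₁ * |(((z.2 1).valMinAbs : ℤ) : ℝ)|) *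
        ‖∑ q : TorusSite 1 (2 * M) × TorusSite 2 L, (torusChar q.1 z.1 * torusChar q.2 z.2) •
          ((((1 / (β * (L : ℝ) ^ 2) : ℝ) : ℂ) ^ 2 *
            (bgmFatMultiplier L M e₀ β (nambuXiCT L μ K) (m + 1) ω (⟨(q.1 0).val, ZMod.val_lt (q.1 0)⟩, q.2) *
              bgmFatMultiplier L M e₀ β (nambuXiCT L μ K) (m + 1) ω' (⟨(q.1 0).val, ZMod.val_lt (q.1 0)⟩, q.2) *
              (sliceSymbolFnXi (β * (L : ℝ) ^ 2) 0 Λ Λ' (matsubaraFreq β M ⟨(q.1 0).val, ZMod.val_lt (q.1 0)⟩) (nambuXiCT L μ K' q.2) -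
                sliceSymbolFnXi (β * (L : ℝ) ^ 2) 0 Λ Λ' (matsubaraFreq β M ⟨(q.1 0).val, ZMod.val_lt (q.1 0)⟩) (nambuXiCT L μ K q.2)))))‖ ≤
      Real.sqrt (524288 * (1 / s₀ + 1) *
          ((1 + 2 * Real.sqrt 2 * s₁ / (s₂ * (Nr - 1)) + 2 * Real.sqrt 2 * s₁ / (s₃' * (Nr - 1))) ^ 2 *
            ((2 * Real.sqrt 2 / (s₂ * (Nr - 1)) + 2) * (2 * Real.sqrt 2 / (s₃ * (Nr - 1)) + 2))
            + (1 / s₁ + 1) ^ 2 / (1 + s₁ * R₀))) *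
        Real.sqrt (24 * (2 * M : ℕ) * (L : ℝ) ^ 2 *
          ((klScale e₀ m * β / π + 1) *
            ((Real.sqrt 2 * L * ((klScale e₀ m + (4 + 4 * A) * ρf ^ 2) / (2 * B.rhomin - 4 * A)) / π + 2) *
              (Real.sqrt 2 * L * (2 * ρf) / π + 2)))) * AΔ := by
  have hL : (0 : ℝ) < L := Nat.cast_pos.2 (Nat.pos_of_ne_zero (NeZero.ne L))
  have hMpos : (0 : ℝ) < ((2 * M : ℕ) : ℝ) := by
    have : 0 < M := Nat.pos_of_ne_zero (NeZero.ne M)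
    exact_mod_cast (by omega : 0 < 2 * M)
  have hπ := Real.pi_pos
  have hΛm : 0 < klScale e₀ m := by rw [klScale]; positivity
  have hA0 : 0 ≤ A := (norm_nonneg _).trans (hA 0 0 (by norm_num))
  have hK10 : 0 ≤ K₁ := le_trans (norm_nonneg _) (hK₁ 0)
  have hK20 : 0 ≤ K₂ := le_trans (norm_nonneg _) (hK₂ 0)
  have hK30 : 0 ≤ K₃ := le_trans (norm_nonneg _) (hK₃ 0)
  have hP0 : 0 ≤ P₀ := (abs_nonneg _).trans (hv₀ 0)
  have hP1 : 0 ≤ P₁ := le_trans (norm_nonneg _) (hv₁ 0)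
  have hP2 : 0 ≤ P₂ := le_trans (norm_nonneg _) (hv₂ 0)
  have hP3 : 0 ≤ P₃ := le_trans (norm_nonneg _) (hv₃ 0)
  have hB10 : 0 ≤ B₁ := (abs_nonneg _).trans (hB₁ 0)
  have hB20 : 0 ≤ B₂ := (abs_nonneg _).trans (hB₂ 0)
  have hB30' : 0 ≤ B₃ := (abs_nonneg _).trans (hB₃ 0)
  have hB40 : 0 ≤ B₄ := (abs_nonneg _).trans (hB₄ 0)
  have hρf0 : 0 ≤ ρf := by
    have hDt : 0 < B.Dtmin - 2 * A := by linarith only [hADt]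
    rw [hρf]; have := B.smax_pos; have := B.Dtmin_pos; have := sectorWidth_pos (m + 1); positivity
  have hℓ₁0 : 0 < ℓ₁ := by rw [hℓ₁]; positivity
  have hNr0 : (0:ℝ) < Nr + 1 / 2 := by linarith only [hNr]
  have hℓ0 : 0 < ℓ := by rw [hℓ]; positivity
  have hKp0 : 0 ≤ Kp := by rw [hKp]; positivity
  have hwsi0 : 0 ≤ wsi := by rw [hwsi]; have := sectorWidth_pos (m + 1); positivity
  have hG₁0 : 0 ≤ G₁ := by rw [hG₁]; positivity
  have hG₂0 : 0 ≤ G₂ := by rw [hG₂]; positivity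
  have hG₃0 : 0 ≤ G₃ := by rw [hG₃]; positivity
  have hκ₃F0 : 0 ≤ κ₃F := by
    rw [hκ₃F]
    have ha30 : 0 ≤ a₃ := le_trans (by have := le_trans (norm_nonneg _) (hA3 0); positivity) ha3
    positivity
  have hcβ : 0 ≤ β * (L : ℝ) ^ 2 := by positivity
  have hc0 : (0 : ℝ) ≤ (1 / (β * (L : ℝ) ^ 2)) ^ 2 := by positivity
  have hAe10 : 0 ≤ Ae1 := by rw [hAe1]; positivity
  have hAe20 : 0 ≤ Ae2 := by rw [hAe2]; positivity
  have hAn10 : 0 ≤ An1 := by rw [hAn1]; positivity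
  have hAn20 : 0 ≤ An2 := by rw [hAn2]; positivity
  have hAv10 : 0 ≤ Av1 := by rw [hAv1]; positivity
  have hAv20 : 0 ≤ Av2 := by rw [hAv2]; positivity
  have hX₀0 : 0 ≤ X₀ := by rw [hX₀]; positivity
  have hX₁0 : 0 ≤ X₁ := by rw [hX₁]; positivity
  have hX₂0 : 0 ≤ X₂ := by rw [hX₂]; positivity
  have hX₃0 : 0 ≤ X₃ := by rw [hX₃]; positivity
  have hTt0 : 0 ≤ Tt := by rw [hTt]; positivity
  have hA3ℓ₁ : 0 ≤ κ₃F * ℓ₁ ^ 3 / klScale e₀ m ^ 3 := by positivity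
  have hA3ℓ : 0 ≤ κ₃F * ℓ ^ 3 / klScale e₀ m ^ 3 := by positivity
  have hs2 : 0 ≤ Real.sqrt 2 := Real.sqrt_nonneg 2
  -- the multiplier data of the fat pair (p3)
  obtain ⟨Gs, hGsdef⟩ : ∃ Gs : TorusSite 1 (2 * M) × TorusSite 2 L → ℂ, Gs = fun q =>
    bgmFatMultiplier L M e₀ β (nambuXiCT L μ K) (m + 1) ω (⟨(q.1 0).val, ZMod.val_lt (q.1 0)⟩, q.2) *
      bgmFatMultiplier L M e₀ β (nambuXiCT L μ K) (m + 1) ω' (⟨(q.1 0).val, ZMod.val_lt (q.1 0)⟩, q.2) := ⟨_, rfl⟩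
  obtain ⟨hM0, hNs, hMt₁, hMt₂, hMt₃, haxes, hnormal, htangent, -⟩ :=
    bgmFatPairWt_data B hA hADt he hz hz1 hgap h3 hlo hhi hβ hρA m hMm hd hd1 hd2 hd3 hA3 ha3 hB0 hB hB30 hB3 hK₂ hNr hLz
      hℓ₁ hℓ hρf hG₁ hG₂ hG₃ hκ₃F hKp hwsi hτt hAe1 hAe2 hAn1 hAn2 hAv1 hAv2 ω ω' v hvj hvtan Gs hGsdef
  have hat₁ : 0 ≤ 2 * G₁ * |2 * π / β| * 1 / klScale e₀ m := by positivity
  have hat₂ : 0 ≤ (4 * G₂ + 2 * G₁) * (2 * π / β) ^ 2 * 1 / klScale e₀ m ^ 2 := by positivity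
  have hat₃ : 0 ≤ (8 * G₃ + 12 * G₂) * |2 * π / β| ^ 3 * 1 / klScale e₀ m ^ 3 := by positivity
  -- the step norms
  have hnorm_u : ∀ (u : Fin 2 → ℤ) (b : ℝ), (∀ j, |(u j : ℝ)| ≤ b) → ‖(fun j => 2 * π / L * (u j : ℝ))‖ ≤ 2 * π / L * b := by
    intro u b hb
    refine (pi_norm_le_iff_of_nonneg (by
      have : 0 ≤ b := (abs_nonneg _).trans (hb 0); positivity)).2 fun j => ?_
    rw [Real.norm_eq_abs, abs_mul, abs_of_pos (by positivity : (0:ℝ) < 2 * π / L)]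
    exact mul_le_mul_of_nonneg_left (hb j) (by positivity)
  have hvb : ‖(fun j => 2 * π / L * (v j : ℝ))‖ ≤ ℓ := by rw [hℓ]; exact hnorm_u v _ hvj
  have hne : ‖(WithLp.toLp 2 (fun i => 2 * π / L * (v i : ℝ)) : EuclideanSpace ℝ (Fin 2))‖ ≤ Real.sqrt 2 * ℓ :=
    (norm_toLp_le _).trans (mul_le_mul_of_nonneg_left hvb (Real.sqrt_nonneg 2))
  have hne_axis : ∀ i : Fin 2, ‖(WithLp.toLp 2 (fun j => 2 * π / L * ((Pi.single i (1 : ℤ) : Fin 2 → ℤ) j : ℝ)) : EuclideanSpace ℝ (Fin 2))‖ ≤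
      Real.sqrt 2 * ℓ₁ := by
    intro i
    refine (norm_toLp_le _).trans (mul_le_mul_of_nonneg_left ?_ (Real.sqrt_nonneg 2))
    rw [hℓ₁]
    have hub : ∀ j, |(((Pi.single i (1 : ℤ) : Fin 2 → ℤ) j : ℤ) : ℝ)| ≤ 1 := by
      intro j; by_cases h : j = i
      · subst h; simp
      · simp [h]
    have := hnorm_u (Pi.single i 1) 1 hub; simpa using this
  have hne_n : ‖(WithLp.toLp 2 (fun j => 2 * π / L * ((![-v 1, v 0] : Fin 2 → ℤ) j : ℝ)) : EuclideanSpace ℝ (Fin 2))‖ ≤ Real.sqrt 2 * ℓ := by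
    refine (norm_toLp_le _).trans (mul_le_mul_of_nonneg_left ?_ (Real.sqrt_nonneg 2))
    rw [hℓ]
    refine hnorm_u _ _ fun j => ?_
    fin_cases j
    · show |(((-v 1 : ℤ) : ℤ) : ℝ)| ≤ Nr + 1 / 2
      rw [Int.cast_neg, abs_neg]; exact hvj 1
    · exact hvj 0
  have hR₀' : 2 * (|v 0| + |v 1|) * (R₀ : ℤ) < L := by
    have h0 := hvj 0; have h1 := hvj 1
    have : (2 * (|(v 0 : ℝ)| + |(v 1 : ℝ)|)) * (R₀ : ℝ) ≤ 2 * (2 * Nr + 1) * (R₀ : ℝ) :=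
      mul_le_mul_of_nonneg_right (by linarith only [h0, h1]) (Nat.cast_nonneg _)
    have : ((2 * (|v 0| + |v 1|) * (R₀ : ℤ) : ℤ) : ℝ) < (L : ℝ) := by
      push_cast; rw [← Int.cast_abs, ← Int.cast_abs]; push_cast; linarith only [this, hR₀]
    exact_mod_cast this
  -- the rate factors
  have hr0pos : 0 < (4 / (s₀ * (2 * M : ℕ))) ^ 3 := by positivity
  have hr1pos : 0 < (4 / (s₁ * L)) ^ 3 := by positivity
  have hr2pos : 0 < (4 / (s₂ * L)) ^ 3 := by positivity
  have hr3pos : 0 < (4 / (s₃ * L)) ^ 2 := by positivity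
  have hr3'pos : 0 < (4 / (s₃' * L)) ^ 3 := by positivity
  -- the six summands of `AΔ` and their nonnegativity
  set SA : ℝ := (1 / (β * (L : ℝ) ^ 2)) ^ 2 * X₀ with hSA
  set S0 : ℝ := Tt / (4 / (s₀ * (2 * M : ℕ))) ^ 3 with hS0
  set E : ℝ := (1 / (β * (L : ℝ) ^ 2)) ^ 2 * ((Real.sqrt 2 * ℓ₁) ^ 3 * X₃ + 3 * (Ae1 * ((Real.sqrt 2 * ℓ₁) ^ 2 * X₂)) +
        3 * (Ae2 * ((Real.sqrt 2 * ℓ₁) * X₁)) + κ₃F * ℓ₁ ^ 3 / klScale e₀ m ^ 3 * X₀) with hE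
  set Nn : ℝ := (1 / (β * (L : ℝ) ^ 2)) ^ 2 * ((Real.sqrt 2 * ℓ) ^ 3 * X₃ + 3 * (An1 * ((Real.sqrt 2 * ℓ) ^ 2 * X₂)) +
        3 * (An2 * ((Real.sqrt 2 * ℓ) * X₁)) + κ₃F * ℓ ^ 3 / klScale e₀ m ^ 3 * X₀) with hNn
  set V2 : ℝ := (1 / (β * (L : ℝ) ^ 2)) ^ 2 * ((Real.sqrt 2 * ℓ) ^ 2 * X₂ + 2 * (Av1 * ((Real.sqrt 2 * ℓ) * X₁)) + Av2 * X₀) with hV2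
  set V3 : ℝ := (1 / (β * (L : ℝ) ^ 2)) ^ 2 * ((Real.sqrt 2 * ℓ) ^ 3 * X₃ + 3 * (Av1 * ((Real.sqrt 2 * ℓ) ^ 2 * X₂)) +
        3 * (Av2 * ((Real.sqrt 2 * ℓ) * X₁)) + κ₃F * ℓ ^ 3 / klScale e₀ m ^ 3 * X₀) with hV3
  have hSA0 : 0 ≤ SA := by positivity
  have hS00 : 0 ≤ S0 := by positivity
  have hE0 : 0 ≤ E := by positivity
  have hNn0 : 0 ≤ Nn := by positivity
  have hV20 : 0 ≤ V2 := by positivity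
  have hV30 : 0 ≤ V3 := by positivity
  have hAΔ' : AΔ = SA + S0 + E / (4 / (s₁ * L)) ^ 3 + Nn / (4 / (s₂ * L)) ^ 3 + V2 / (4 / (s₃ * L)) ^ 2 + V3 / (4 / (s₃' * L)) ^ 3 := by
    rw [hAΔ]
  have hE' : 0 ≤ E / (4 / (s₁ * L)) ^ 3 := by positivity
  have hNn' : 0 ≤ Nn / (4 / (s₂ * L)) ^ 3 := by positivity
  have hV2' : 0 ≤ V2 / (4 / (s₃ * L)) ^ 2 := by positivity
  have hV3' : 0 ≤ V3 / (4 / (s₃' * L)) ^ 3 := by positivity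
  -- each summand is dominated by `AΔ` times its rate factor
  have hA : (1 / (β * (L : ℝ) ^ 2)) ^ 2 * ((16 * B₁ + 16) * (β * (L : ℝ) ^ 2) / Λ ^ 2 * P₀) ≤ AΔ := by
    rw [hAΔ', ← hX₀]; linarith
  have hT0 : Tt ≤ AΔ * (4 / (s₀ * (2 * M : ℕ))) ^ 3 := by
    refine le_mul_of_div_le' hr0pos ?_
    rw [hAΔ']; linarith
  have hTE : E ≤ AΔ * (4 / (s₁ * L)) ^ 3 := by
    refine le_mul_of_div_le' hr1pos ?_
    rw [hAΔ']; linarith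
  have hTN : Nn ≤ AΔ * (4 / (s₂ * L)) ^ 3 := by
    refine le_mul_of_div_le' hr2pos ?_
    rw [hAΔ']; linarith
  have hTV2 : V2 ≤ AΔ * (4 / (s₃ * L)) ^ 2 := by
    refine le_mul_of_div_le' hr3pos ?_
    rw [hAΔ']; linarith
  have hTV3 : V3 ≤ AΔ * (4 / (s₃' * L)) ^ 3 := by
    refine le_mul_of_div_le' hr3'pos ?_
    rw [hAΔ']; linarith
  -- the increment pair lemma
  have hmain := sliceIncrPairWt_charSum_l1_le (K := K) (K' := K') hβ hΛ hΛΛ' hM' hK₁ hK₂ hK₃ hv₀ hv₁ hv₂ hv₃ hB₁ hB₂ hB₃ hB₄ Gs hM0 le_rfl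
    v hv hR₀' hat₁ hat₂ hat₃ hMt₁ hMt₂ hMt₃
    (fun _ => Ae1) (fun _ => Ae2) (fun _ => κ₃F * ℓ₁ ^ 3 / klScale e₀ m ^ 3) (fun _ => hAe10) (fun _ => hAe20) (fun _ => hA3ℓ₁)
    (fun q i => (haxes i).1 q) (fun q i => (haxes i).2.1 q) (fun q i => (haxes i).2.2 q)
    hAn10 hAn20 hA3ℓ hnormal.1 hnormal.2.1 hnormal.2.2 hAv10 hAv20 hA3ℓ htangent.1 htangent.2.1 htangent.2.2
    (A₀ := AΔ) hA hs₀ hs₁ hs₂ hs₃ hs₃'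
    -- time
    (by rw [← hTt]; exact hT0)
    -- axes
    (fun i => by
      rw [incrLhs3_eq, ← hX₀, ← hX₁, ← hX₂, ← hX₃]
      exact (incrPoly3_mono hc0 hX₁0 hX₂0 hX₃0 hAe10 hAe20 (norm_nonneg _) (hne_axis i)).trans hTE)
    -- normal
    (by
      rw [incrLhs3_eq, ← hX₀, ← hX₁, ← hX₂, ← hX₃]
      exact (incrPoly3_mono hc0 hX₁0 hX₂0 hX₃0 hAn10 hAn20 (norm_nonneg _) hne_n).trans hTN)
    -- along `v`, second order
    (by
      rw [incrLhs2_eq, ← hX₀, ← hX₁, ← hX₂]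
      exact (incrPoly2_mono hc0 hX₁0 hX₂0 hAv10 (norm_nonneg _) hne).trans hTV2)
    -- along `v`, third order
    (by
      rw [incrLhs3_eq, ← hX₀, ← hX₁, ← hX₂, ← hX₃]
      exact (incrPoly3_mono hc0 hX₁0 hX₂0 hX₃0 hAv10 hAv20 (norm_nonneg _) hne).trans hTV3)
  -- identify the symbol and compare the weight constant and the support count
  have hLHS : ∀ q : TorusSite 1 (2 * M) × TorusSite 2 L,
      bgmFatMultiplier L M e₀ β (nambuXiCT L μ K) (m + 1) ω (⟨(q.1 0).val, ZMod.val_lt (q.1 0)⟩, q.2) *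
        bgmFatMultiplier L M e₀ β (nambuXiCT L μ K) (m + 1) ω' (⟨(q.1 0).val, ZMod.val_lt (q.1 0)⟩, q.2) *
        (sliceSymbolFnXi (β * (L : ℝ) ^ 2) 0 Λ Λ' (matsubaraFreq β M ⟨(q.1 0).val, ZMod.val_lt (q.1 0)⟩) (nambuXiCT L μ K' q.2) -
          sliceSymbolFnXi (β * (L : ℝ) ^ 2) 0 Λ Λ' (matsubaraFreq β M ⟨(q.1 0).val, ZMod.val_lt (q.1 0)⟩) (nambuXiCT L μ K q.2)) =
      Gs q * (sliceSymbolFnXi (β * (L : ℝ) ^ 2) 0 Λ Λ' (matsubaraFreq β M ⟨(q.1 0).val, ZMod.val_lt (q.1 0)⟩) (nambuXiCT L μ K' q.2) -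
          sliceSymbolFnXi (β * (L : ℝ) ^ 2) 0 Λ Λ' (matsubaraFreq β M ⟨(q.1 0).val, ZMod.val_lt (q.1 0)⟩) (nambuXiCT L μ K q.2)) := by
    intro q; rw [hGsdef]
  simp_rw [hLHS]
  refine hmain.trans ?_
  have hAΔ0 : 0 ≤ AΔ := by rw [hAΔ']; positivity
  have hvpos : 0 < Real.sqrt ((v 0 : ℝ) ^ 2 + (v 1 : ℝ) ^ 2) := lt_of_lt_of_le (by linarith only [hNr]) hvlen
  have hNr1 : 0 < Nr - 1 := by linarith only [hNr]
  have hW : 524288 * (1 / s₀ + 1) *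
        ((1 + 2 * Real.sqrt 2 * s₁ / (s₂ * Real.sqrt ((v 0 : ℝ) ^ 2 + (v 1 : ℝ) ^ 2)) +
            2 * Real.sqrt 2 * s₁ / (s₃' * Real.sqrt ((v 0 : ℝ) ^ 2 + (v 1 : ℝ) ^ 2))) ^ 2 *
          ((2 * Real.sqrt 2 / (s₂ * Real.sqrt ((v 0 : ℝ) ^ 2 + (v 1 : ℝ) ^ 2)) + 2) *
            (2 * Real.sqrt 2 / (s₃ * Real.sqrt ((v 0 : ℝ) ^ 2 + (v 1 : ℝ) ^ 2)) + 2))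
          + (1 / s₁ + 1) ^ 2 / (1 + s₁ * R₀)) ≤
      524288 * (1 / s₀ + 1) *
        ((1 + 2 * Real.sqrt 2 * s₁ / (s₂ * (Nr - 1)) + 2 * Real.sqrt 2 * s₁ / (s₃' * (Nr - 1))) ^ 2 *
          ((2 * Real.sqrt 2 / (s₂ * (Nr - 1)) + 2) * (2 * Real.sqrt 2 / (s₃ * (Nr - 1)) + 2))
          + (1 / s₁ + 1) ^ 2 / (1 + s₁ * R₀)) := by
    have h2 : 2 * Real.sqrt 2 / (s₂ * Real.sqrt ((v 0 : ℝ) ^ 2 + (v 1 : ℝ) ^ 2)) ≤ 2 * Real.sqrt 2 / (s₂ * (Nr - 1)) :=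
      div_le_div_of_nonneg_left (by positivity) (by positivity) (mul_le_mul_of_nonneg_left hvlen hs₂.le)
    have h3 : 2 * Real.sqrt 2 / (s₃ * Real.sqrt ((v 0 : ℝ) ^ 2 + (v 1 : ℝ) ^ 2)) ≤ 2 * Real.sqrt 2 / (s₃ * (Nr - 1)) :=
      div_le_div_of_nonneg_left (by positivity) (by positivity) (mul_le_mul_of_nonneg_left hvlen hs₃.le)
    have h4 : 2 * Real.sqrt 2 * s₁ / (s₂ * Real.sqrt ((v 0 : ℝ) ^ 2 + (v 1 : ℝ) ^ 2)) ≤ 2 * Real.sqrt 2 * s₁ / (s₂ * (Nr - 1)) :=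
      div_le_div_of_nonneg_left (by positivity) (by positivity) (mul_le_mul_of_nonneg_left hvlen hs₂.le)
    have h5 : 2 * Real.sqrt 2 * s₁ / (s₃' * Real.sqrt ((v 0 : ℝ) ^ 2 + (v 1 : ℝ) ^ 2)) ≤ 2 * Real.sqrt 2 * s₁ / (s₃' * (Nr - 1)) :=
      div_le_div_of_nonneg_left (by positivity) (by positivity) (mul_le_mul_of_nonneg_left hvlen hs₃'.le)
    have h20 : 0 ≤ 2 * Real.sqrt 2 / (s₂ * Real.sqrt ((v 0 : ℝ) ^ 2 + (v 1 : ℝ) ^ 2)) := by positivity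
    have h30 : 0 ≤ 2 * Real.sqrt 2 / (s₃ * Real.sqrt ((v 0 : ℝ) ^ 2 + (v 1 : ℝ) ^ 2)) := by positivity
    have h40 : 0 ≤ 1 + 2 * Real.sqrt 2 * s₁ / (s₂ * Real.sqrt ((v 0 : ℝ) ^ 2 + (v 1 : ℝ) ^ 2)) +
        2 * Real.sqrt 2 * s₁ / (s₃' * Real.sqrt ((v 0 : ℝ) ^ 2 + (v 1 : ℝ) ^ 2)) := by positivity
    gcongr
  have hcardR : (24 * ((2 * M : ℕ) : ℝ) * (L : ℝ) ^ 2 * (((univ.filter fun q => Gs q ≠ 0).card : ℕ) : ℝ)) ≤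
      24 * ((2 * M : ℕ) : ℝ) * (L : ℝ) ^ 2 *
        ((klScale e₀ m * β / π + 1) *
          ((Real.sqrt 2 * L * ((klScale e₀ m + (4 + 4 * A) * ρf ^ 2) / (2 * B.rhomin - 4 * A)) / π + 2) *
            (Real.sqrt 2 * L * (2 * ρf) / π + 2))) :=
    mul_le_mul_of_nonneg_left hNs (by positivity)
  gcongr

end PairBound

end Summit.HubbardSuperconductivity.HubbardSuperconductivity.Theorems.TorusFourierL2

end
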